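import Summits.ABC.IUTFork.Thm311RealInd1StripTwistJWOddBasis
import Summits.ABC.IUTFork.Thm311RealInd1StripBaseLine
import Summits.ABC.IUTFork.Thm311RealInd1StripDegOne
import HarnessLib

/-!
# [IUTchIII] Thm 3.11 (i) (Ind1) at `v ∈ 𝕍^non`, ODD local degree: the BASE LINE `ℚ_p·1 ⊆ K_v` under print's (Ind1) strip part —
# Kondo's OPEN odd-degree question made kernel-precise (a DICHOTOMY decided by one bit), modulo `JannsenWingbergTwists`

PROOF-ONLY file (abc-iut cell, Cor. 3.12 sub-crew, seat abc-iut-c312-1 = holder of record of the typed [IUTchIII] Thm. 3.11,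
gen 13; row «R15 ODD-DEGREE BASE LINE», part b).  TAKES NO SIDE on [IUTchIII] Cor. 3.12.

Gen 12 (`Thm311RealInd1StripBaseLine`, p502894) put Kondo's Lemma 2.5 (1) / Hoshi–Nishio's Lemma 2.4 in the kernel modulo
`JannsenWingbergTwistsFirst`: at every `v ∣ p` odd of EVEN local degree print's (Ind1) strip part moves the base line `ℚ_p·1` off
itself.  For ODD local degree `d = [K_v : ℚ_p] ≥ 3` print records the question as OPEN — K. Kondo, arXiv:2512.09231, p. 5: «when
`k/ℚ_p` is of odd degree, since it is not clear to the author whether or not there exists an element of `Out(G_k)` that does not preserve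
the `ℚ_p`-subspace `(ℚ_p)_+ ⊆ k_+` …» and the Remark after the proof of Thm. 2.6, p. 12: «In the case where `d_k` is odd, a proof analogous to
that of Theorem (Aut-intristic Hodge-Tate) would require an element `α ∈ Aut(G_k)` such that `α_+(y_1) ≠ y_1`» (Lemma 2.5 is stated for
EVEN `d_k` only).  This file makes the odd-degree situation KERNEL-PRECISE at the real log-shells, modulo the GROUP-level named fact
`JannsenWingbergTwists` (v1, p491207 — no new fact), over the realised basis of part a (`Thm311RealInd1StripTwistJWOddBasis`: `y : Fin 1 ⊕
Fin g × Fin 2`, all `2g` plane transvections in `Real.ind1StripOf v (Real.galoisLog v)`, `span(planes) = Ker(Tr)`, `Tr(y_{inl 0}) ≠ 0`).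
Writing `1 = λ·y_{inl 0} + κ` with `κ ∈ Ker(Tr)`:
* `Real.apply_algebraMap_not_mem_range_of_shear` / `Real.apply_algebraMap_eq_of_shear` — a shear `x ↦ x + f(x)·w` along a trace-zero
  `w ≠ 0` carries `a·1`, `a ≠ 0`, OUT of `ℚ_p·1` if `f(1) ≠ 0`, and fixes `ℚ_p·1` pointwise if `f(1) = 0`;
* **`Real.baseLine_dichotomy_of_jannsenWingberg_odd`** — THE DICHOTOMY: EITHER `1 ∉ ℚ_p·y_{inl 0}` (some plane coordinate of `1` is non-zero)
  and then some realised twist carries `a·1 ∉ ℚ_p·1` for every `a ≠ 0` — the base line is MOVED OFF ITSELF exactly as at even degree —, OR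
  `1 ∈ ℚ_p·y_{inl 0}` (the base line IS the Jannsen–Wingberg residual line) and then EVERY realised plane twist fixes `ℚ_p·1` POINTWISE;
* `Real.exists_mem_ind1StripOf_not_baseLinePreserving_or_residual_of_jannsenWingberg_odd` (+ `Real.not_mapsTo_baseLine_of_moves`, the
  analytic-log twin) — short form: «some strip automorphism is not `(ℚ_p)_+`-characteristic ∨ the base line is the residual line of a realised
  Jannsen–Wingberg basis»;
* `Real.baseLine_census_of_jannsenWingberg` — the three local-degree regimes side by side at `v ∣ p` odd: `d = 1`: strip part `= {1}`
  (gen 8 p453109, unconditional); `d` even: moved (gen 12, mod `JannsenWingbergTwistsFirst`); `d` odd `≥ 3`: the dichotomy (mod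
  `JannsenWingbergTwists`).
Reading for the record (neutral, OUR typed objects, one finite place): modulo the Jannsen–Wingberg structure theorem, whether print's (Ind1)
strip part moves the base line `ℚ_p ⊆ K_v` at a place of ODD local degree `≥ 3` through the realised twists is decided by ONE bit — whether the
Jannsen–Wingberg residual generator `y_1 = log θ⁻¹[x_1]` is `ℚ_p`-proportional to `1` —, a bit print does not pin (Kondo, loc. cit.: open);
other elements of `Aut(G_v)` are not excluded from moving it.  HONEST SCOPE: conditional on the named fact(s) displayed as binders; nothing here
asserts or refutes [IUTchIII] Cor. 3.12; NO abc claim.  [claim: Mochizuki2012, status: disputed]; [cite: Kondo2025OuterAutMLF, §1 p.5, §2 Thm 2.3,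
Lemma 2.5, Remark p.12]; [cite: HoshiNishio2022OuterAutMLF, Def 2.1 (i), Lemma 2.4, Rmk 2.5 p.8]; [cite: JannsenWingberg1982, Thm 2 p.75 and
§5.1 p.96]; [cite: DupuyHilado2025, §4.7].  typed ≠ proved; a conditional theorem discharges nothing it binds.
-/


set_option autoImplicit false

noncomputable section

open Metric Set
open scoped Pointwise

namespace Summit.ABC.IUTFork.Thm311.Real

open NumberField IsDedekindDomain Literature.NumberTheory.NumberFields Literature.IUT.LogVolume
open Literature.NumberTheory.GaloisRepresentations
open Literature.AnabelianGeometry.AbsoluteAnabelian Literature.IUT.HodgeArakelov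
open Literature.IUT.HodgeArakelov.AbsTopMonoids

variable {F : Type} [Field F] [NumberField F] (v : HeightOneSpectrum (𝓞 F))

/-! ## 1. A shear along a trace-zero vector and the base line -/

/-- **A shear along a trace-zero vector moves the base line iff its coefficient does not vanish at `1` (moving half).**  Let `ψ` act on
`K_v^{(1/n_v)}` as `x ↦ x + f(x)·w` with `f` `ℚ_p`-linear, `Tr(w) = 0`, `w ≠ 0`.  If `f(1) ≠ 0` then for every `a ∈ ℚ_p`, `a ≠ 0`:
`ψ(a·1) ∉ ℚ_p·1` — indeed `ψ(a) = b` forces `b = a` by taking traces (`Tr(a·1) = d·a`, `d ≠ 0`), whence `a·f(1)·w = 0`. [folklore] -/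
theorem apply_algebraMap_not_mem_range_of_shear (p : ℕ) [Fact p.Prime] (hv : ((p : ℕ) : 𝓞 F) ∈ v.asIdeal)
    {ψ : v.adicCompletion F ≃+ v.adicCompletion F} {f : RescaledCompletion F p v hv →ₗ[ℚ_[p]] ℚ_[p]} {w : RescaledCompletion F p v hv}
    (hψ : ∀ x : RescaledCompletion F p v hv,
      RescaledCompletion.of F p v hv (ψ ((RescaledCompletion.of F p v hv).symm x)) = x + f x • w)
    (hw : Algebra.trace ℚ_[p] (RescaledCompletion F p v hv) w = 0) (hw0 : w ≠ 0) (hf : f 1 ≠ 0)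
    (a : ℚ_[p]) (ha : a ≠ 0) :
    RescaledCompletion.of F p v hv (ψ ((RescaledCompletion.of F p v hv).symm (algebraMap ℚ_[p] (RescaledCompletion F p v hv) a))) ∉
      Set.range (algebraMap ℚ_[p] (RescaledCompletion F p v hv)) := by
  haveI : FiniteDimensional ℚ_[p] (RescaledCompletion F p v hv) := FiniteDimensional.of_locallyCompactSpace ℚ_[p]
  set Tr := Algebra.trace ℚ_[p] (RescaledCompletion F p v hv) with hTr
  have hfin : Module.finrank ℚ_[p] (RescaledCompletion F p v hv) = localDeg F v :=
    (RescaledCompletion.localDeg_eq_finrank F p v hv).symm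
  have hTra : ∀ b : ℚ_[p], Tr (algebraMap ℚ_[p] (RescaledCompletion F p v hv) b) = (localDeg F v : ℚ_[p]) * b := by
    intro b
    rw [hTr, Algebra.trace_algebraMap, hfin, nsmul_eq_mul]
  have hd0 : (localDeg F v : ℚ_[p]) ≠ 0 := by exact_mod_cast (localDeg_pos F v).ne'
  rintro ⟨b, hb⟩
  rw [hψ] at hb
  have hfa : f (algebraMap ℚ_[p] (RescaledCompletion F p v hv) a) = a * f 1 := by
    rw [Algebra.algebraMap_eq_smul_one, map_smul, smul_eq_mul]
  rw [hfa] at hb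
  -- traces: `d·b = d·a`
  have htr := congrArg Tr hb
  rw [map_add, map_smul, hw, smul_zero, add_zero, hTra, hTra] at htr
  have hba : b = a := mul_left_cancel₀ hd0 htr
  rw [hba, left_eq_add, smul_eq_zero] at hb
  rcases hb with h | h
  · exact (mul_ne_zero ha hf) h
  · exact hw0 h

/-- **… and fixes the base line pointwise iff the coefficient vanishes at `1` (fixed half).**  With `ψ(x) = x + f(x)·w` as above and
`f(1) = 0`: `ψ(a·1) = a·1` for every `a ∈ ℚ_p` (`f(a·1) = a·f(1) = 0`). [folklore] -/
theorem apply_algebraMap_eq_of_shear (p : ℕ) [Fact p.Prime] (hv : ((p : ℕ) : 𝓞 F) ∈ v.asIdeal)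
    {ψ : v.adicCompletion F ≃+ v.adicCompletion F} {f : RescaledCompletion F p v hv →ₗ[ℚ_[p]] ℚ_[p]} {w : RescaledCompletion F p v hv}
    (hψ : ∀ x : RescaledCompletion F p v hv,
      RescaledCompletion.of F p v hv (ψ ((RescaledCompletion.of F p v hv).symm x)) = x + f x • w)
    (hf : f 1 = 0) (a : ℚ_[p]) :
    RescaledCompletion.of F p v hv (ψ ((RescaledCompletion.of F p v hv).symm (algebraMap ℚ_[p] (RescaledCompletion F p v hv) a))) =
      algebraMap ℚ_[p] (RescaledCompletion F p v hv) a := by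
  rw [hψ, Algebra.algebraMap_eq_smul_one, map_smul, hf, smul_eq_mul, mul_zero, zero_smul, add_zero]

/-! ## 2. THE DICHOTOMY at odd local degree -/

/-- **THE ODD-DEGREE BASE-LINE DICHOTOMY (Kondo's open question made kernel-precise), modulo `JannsenWingbergTwists`.**  At a finite place
`v ∣ p` of a number field with `p` odd and `d = [K_v : ℚ_p] ≥ 3` ODD, for the realised Jannsen–Wingberg basis `y : Fin 1 ⊕ Fin g × Fin 2` of
part a (all `2g` plane transvections `ψ i, ψ' i ∈ Real.ind1StripOf v (Real.galoisLog v)`; `span(planes) = Ker(Tr)`, `Tr(y_{inl 0}) ≠ 0`):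
EITHER
* `1 ∉ ℚ_p·y_{inl 0}` — some plane coordinate of `1 = λ·y_{inl 0} + κ`, `κ ∈ Ker(Tr)`, is non-zero — and then some `χ` among the realised
  twists carries `a·1 ∉ ℚ_p·1` for EVERY `a ≠ 0`: the base line is MOVED OFF ITSELF (as at even degree, gen 12);
OR
* `1 ∈ ℚ_p·y_{inl 0}` — the base line IS the Jannsen–Wingberg residual line `ℚ_p·y_1` — and then EVERY realised plane twist `ψ i, ψ' i` fixes
  `ℚ_p·1` POINTWISE.
Print does not pin which (Kondo, arXiv:2512.09231 p. 5: «not clear to the author whether or not there exists an element of `Out(G_k)` that does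
not preserve … `(ℚ_p)_+ ⊆ k_+`» for odd degree; Remark p. 12: «would require an element `α ∈ Aut(G_k)` such that `α_+(y_1) ≠ y_1`»); other
elements of `Aut(G_v)` than the realised twists are not excluded from moving the base line in the second branch.
[claim: Mochizuki2012, status: disputed] [cite: Kondo2025OuterAutMLF, §1 p.5, §2 Thm 2.3, Remark p.12]
[cite: HoshiNishio2022OuterAutMLF, Def 2.1 (i), Rmk 2.5 p.8] [cite: JannsenWingberg1982, §5.1 p.96] -/
theorem baseLine_dichotomy_of_jannsenWingberg_odd (hJW : JannsenWingbergTwists)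
    (p : ℕ) [Fact p.Prime] (hv : ((p : ℕ) : 𝓞 F) ∈ v.asIdeal) (hp2 : p ≠ 2) (h3 : 3 ≤ localDeg F v) (hodd : Odd (localDeg F v)) :
    ∃ (g : ℕ) (_ : localDeg F v = 1 + 2 * g) (y : Module.Basis (Fin 1 ⊕ Fin g × Fin 2) ℚ_[p] (RescaledCompletion F p v hv))
      (ψ ψ' : Fin g → (v.adicCompletion F ≃+ v.adicCompletion F)),
      (∀ i, ψ i ∈ ind1StripOf v (galoisLog v)) ∧ (∀ i, ψ' i ∈ ind1StripOf v (galoisLog v)) ∧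
      (∀ i (x : RescaledCompletion F p v hv),
        RescaledCompletion.of F p v hv (ψ i ((RescaledCompletion.of F p v hv).symm x)) =
          x + y.coord (Sum.inr (i, 1)) x • y (Sum.inr (i, 0))) ∧
      (∀ i (x : RescaledCompletion F p v hv),
        RescaledCompletion.of F p v hv (ψ' i ((RescaledCompletion.of F p v hv).symm x)) =
          x - y.coord (Sum.inr (i, 0)) x • y (Sum.inr (i, 1))) ∧
      Submodule.span ℚ_[p] (Set.range fun iε : Fin g × Fin 2 => y (Sum.inr iε)) =
        LinearMap.ker (Algebra.trace ℚ_[p] (RescaledCompletion F p v hv)) ∧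
      Algebra.trace ℚ_[p] (RescaledCompletion F p v hv) (y (Sum.inl 0)) ≠ 0 ∧
      (((1 : RescaledCompletion F p v hv) ∉ ℚ_[p] ∙ y (Sum.inl 0) ∧
          ∃ χ ∈ ind1StripOf v (galoisLog v), ∀ a : ℚ_[p], a ≠ 0 →
            RescaledCompletion.of F p v hv (χ ((RescaledCompletion.of F p v hv).symm
                (algebraMap ℚ_[p] (RescaledCompletion F p v hv) a))) ∉
              Set.range (algebraMap ℚ_[p] (RescaledCompletion F p v hv))) ∨
        ((1 : RescaledCompletion F p v hv) ∈ ℚ_[p] ∙ y (Sum.inl 0) ∧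
          ∀ i (a : ℚ_[p]),
            RescaledCompletion.of F p v hv (ψ i ((RescaledCompletion.of F p v hv).symm
                (algebraMap ℚ_[p] (RescaledCompletion F p v hv) a))) = algebraMap ℚ_[p] (RescaledCompletion F p v hv) a ∧
            RescaledCompletion.of F p v hv (ψ' i ((RescaledCompletion.of F p v hv).symm
                (algebraMap ℚ_[p] (RescaledCompletion F p v hv) a))) = algebraMap ℚ_[p] (RescaledCompletion F p v hv) a)) := by
  obtain ⟨g, hcard, y, ψ, ψ', hψ, hψ', hT, hT', htp, hspan, ht1⟩ :=
    exists_realised_basis_trace_of_jannsenWingberg_odd v hJW p hv hp2 h3 hodd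
  refine ⟨g, hcard, y, ψ, ψ', hψ, hψ', hT, hT', hspan, ht1, ?_⟩
  have hcoord : ∀ s t : Fin 1 ⊕ Fin g × Fin 2, y.coord s (y t) = if t = s then 1 else 0 := by
    intro s t
    rw [Module.Basis.coord_apply, Module.Basis.repr_self, Finsupp.single_apply]
  -- `1 ∈ ℚ_p·y_{inl 0}` iff every plane coordinate of `1` vanishes
  have hmem_iff : (1 : RescaledCompletion F p v hv) ∈ ℚ_[p] ∙ y (Sum.inl 0) ↔
      ∀ iε : Fin g × Fin 2, y.coord (Sum.inr iε) 1 = 0 := by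
    constructor
    · intro h iε
      obtain ⟨a, ha⟩ := Submodule.mem_span_singleton.mp h
      rw [← ha, map_smul, hcoord, if_neg Sum.inl_ne_inr, smul_zero]
    · intro h
      refine Submodule.mem_span_singleton.mpr ⟨y.coord (Sum.inl 0) 1, ?_⟩
      conv_rhs => rw [← y.sum_repr (1 : RescaledCompletion F p v hv)]
      rw [Fintype.sum_sum_type, Finset.sum_eq_zero (s := (Finset.univ : Finset (Fin g × Fin 2)))
        (fun iε _ => by rw [← Module.Basis.coord_apply, h iε, zero_smul]), add_zero,
        Fintype.sum_unique, Module.Basis.coord_apply]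
      rfl
  by_cases hall : ∀ iε : Fin g × Fin 2, y.coord (Sum.inr iε) 1 = 0
  · -- second branch: the base line is the residual line; every realised twist fixes it pointwise
    refine Or.inr ⟨hmem_iff.mpr hall, fun i a => ⟨?_, ?_⟩⟩
    · exact apply_algebraMap_eq_of_shear v p hv (f := y.coord (Sum.inr (i, 1))) (w := y (Sum.inr (i, 0))) (hT i) (hall (i, 1)) a
    · have hT'' : ∀ x : RescaledCompletion F p v hv,
          RescaledCompletion.of F p v hv (ψ' i ((RescaledCompletion.of F p v hv).symm x)) =
            x + y.coord (Sum.inr (i, 0)) x • (-y (Sum.inr (i, 1))) := fun x => by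
        rw [hT', smul_neg, sub_eq_add_neg]
      exact apply_algebraMap_eq_of_shear v p hv (f := y.coord (Sum.inr (i, 0))) (w := -y (Sum.inr (i, 1))) hT'' (hall (i, 0)) a
  · -- first branch: some plane coordinate of `1` is non-zero; the corresponding twist moves the base line
    push Not at hall
    obtain ⟨⟨i, ε⟩, hne⟩ := hall
    refine Or.inl ⟨fun hmem => hne (hmem_iff.mp hmem (i, ε)), ?_⟩
    fin_cases ε
    · -- `y^*_{(i,0)}(1) ≠ 0`: use `ψ' i : x ↦ x − y^*_{(i,0)}(x)·y_{(i,1)}`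
      have hT'' : ∀ x : RescaledCompletion F p v hv,
          RescaledCompletion.of F p v hv (ψ' i ((RescaledCompletion.of F p v hv).symm x)) =
            x + y.coord (Sum.inr (i, 0)) x • (-y (Sum.inr (i, 1))) := fun x => by
        rw [hT', smul_neg, sub_eq_add_neg]
      exact ⟨ψ' i, hψ' i, fun a ha =>
        apply_algebraMap_not_mem_range_of_shear v p hv hT'' (by rw [map_neg, htp, neg_zero]) (neg_ne_zero.mpr (y.ne_zero _)) hne a ha⟩
    · -- `y^*_{(i,1)}(1) ≠ 0`: use `ψ i : x ↦ x + y^*_{(i,1)}(x)·y_{(i,0)}`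
      exact ⟨ψ i, hψ i, fun a ha =>
        apply_algebraMap_not_mem_range_of_shear v p hv (hT i) (htp (i, 0)) (y.ne_zero _) hne a ha⟩

/-- **The moved branch as a `MapsTo` statement**: an automorphism `χ` of `K_v` carrying `a·1 ∉ ℚ_p·1` for every `a ≠ 0` does NOT map the
base line `ℚ_p·1 = range(ℚ_p → K_v^{(1/n_v)})` into itself (not «`(ℚ_p)_+`-characteristic», Hoshi–Nishio Def. 2.1 (i)); used to read the first
branch of `baseLine_dichotomy_of_jannsenWingberg_odd` in the currency of gen 12's even-degree statement of record.
[claim: Mochizuki2012, status: disputed] [cite: HoshiNishio2022OuterAutMLF, Def 2.1 (i) p.8] -/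
theorem not_mapsTo_baseLine_of_moves (p : ℕ) [Fact p.Prime] (hv : ((p : ℕ) : 𝓞 F) ∈ v.asIdeal)
    {χ : v.adicCompletion F ≃+ v.adicCompletion F}
    (hχ : ∀ a : ℚ_[p], a ≠ 0 →
      RescaledCompletion.of F p v hv (χ ((RescaledCompletion.of F p v hv).symm (algebraMap ℚ_[p] (RescaledCompletion F p v hv) a))) ∉
        Set.range (algebraMap ℚ_[p] (RescaledCompletion F p v hv))) :
    ¬ Set.MapsTo (fun x => RescaledCompletion.of F p v hv (χ ((RescaledCompletion.of F p v hv).symm x)))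
        (Set.range (algebraMap ℚ_[p] (RescaledCompletion F p v hv)))
        (Set.range (algebraMap ℚ_[p] (RescaledCompletion F p v hv))) :=
  fun hmaps => hχ 1 one_ne_zero (hmaps ⟨1, rfl⟩)

/-- **STATEMENT OF RECORD (odd degree, short form).**  Assume `JannsenWingbergTwists`.  At every finite place `v ∣ p` of a number field with
`p` odd and `[K_v : ℚ_p] ≥ 3` ODD: EITHER some `ψ ∈ Real.ind1StripOf v (Real.galoisLog v)` does not map the base line
`ℚ_p·1 = range(ℚ_p → K_v^{(1/n_v)})` into itself («not `(ℚ_p)_+`-characteristic», Hoshi–Nishio Def. 2.1 (i)), OR there is a `ℚ_p`-basis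
`y : Fin 1 ⊕ Fin g × Fin 2` of `K_v^{(1/n_v)}` whose `2g` plane vectors span `Ker(Tr)`, whose `2g` plane transvections are ALL realised in
`Real.ind1StripOf v (Real.galoisLog v)`, and with `1 ∈ ℚ_p·y_{inl 0}` — so that every realised twist fixes `ℚ_p·1` pointwise (§2).  Which branch
holds is not pinned by print (Kondo p. 5, p. 12: open). [claim: Mochizuki2012, status: disputed] [cite: Kondo2025OuterAutMLF, §1 p.5, Remark p.12]
[cite: HoshiNishio2022OuterAutMLF, Def 2.1 (i), Rmk 2.5 p.8] [cite: DupuyHilado2025, §4.7] -/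
theorem exists_mem_ind1StripOf_not_baseLinePreserving_or_residual_of_jannsenWingberg_odd (hJW : JannsenWingbergTwists)
    (p : ℕ) [Fact p.Prime] (hv : ((p : ℕ) : 𝓞 F) ∈ v.asIdeal) (hp2 : p ≠ 2) (h3 : 3 ≤ localDeg F v) (hodd : Odd (localDeg F v)) :
    (∃ ψ : v.adicCompletion F ≃+ v.adicCompletion F, ψ ∈ ind1StripOf v (galoisLog v) ∧
      ¬ Set.MapsTo (fun x => RescaledCompletion.of F p v hv (ψ ((RescaledCompletion.of F p v hv).symm x)))
          (Set.range (algebraMap ℚ_[p] (RescaledCompletion F p v hv)))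
          (Set.range (algebraMap ℚ_[p] (RescaledCompletion F p v hv)))) ∨
    (∃ (g : ℕ) (_ : localDeg F v = 1 + 2 * g) (y : Module.Basis (Fin 1 ⊕ Fin g × Fin 2) ℚ_[p] (RescaledCompletion F p v hv))
      (ψ ψ' : Fin g → (v.adicCompletion F ≃+ v.adicCompletion F)),
      (∀ i, ψ i ∈ ind1StripOf v (galoisLog v)) ∧ (∀ i, ψ' i ∈ ind1StripOf v (galoisLog v)) ∧
      (∀ i (x : RescaledCompletion F p v hv),
        RescaledCompletion.of F p v hv (ψ i ((RescaledCompletion.of F p v hv).symm x)) =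
          x + y.coord (Sum.inr (i, 1)) x • y (Sum.inr (i, 0))) ∧
      (∀ i (x : RescaledCompletion F p v hv),
        RescaledCompletion.of F p v hv (ψ' i ((RescaledCompletion.of F p v hv).symm x)) =
          x - y.coord (Sum.inr (i, 0)) x • y (Sum.inr (i, 1))) ∧
      Submodule.span ℚ_[p] (Set.range fun iε : Fin g × Fin 2 => y (Sum.inr iε)) =
        LinearMap.ker (Algebra.trace ℚ_[p] (RescaledCompletion F p v hv)) ∧
      (1 : RescaledCompletion F p v hv) ∈ ℚ_[p] ∙ y (Sum.inl 0)) := by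
  obtain ⟨g, hcard, y, ψ, ψ', hψ, hψ', hT, hT', hspan, -, hdich⟩ := baseLine_dichotomy_of_jannsenWingberg_odd v hJW p hv hp2 h3 hodd
  rcases hdich with ⟨-, χ, hχ, hmove⟩ | ⟨hmem, -⟩
  · exact Or.inl ⟨χ, hχ, not_mapsTo_baseLine_of_moves v p hv hmove⟩
  · exact Or.inr ⟨g, hcard, y, ψ, ψ', hψ, hψ', hT, hT', hspan, hmem⟩

/-! ## 3. The three local-degree regimes side by side -/

/-- **CENSUS OF THE BASE-LINE QUESTION over the local degree, at `v ∣ p` odd** (print's (Ind1) strip part through the Galois logarithm):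
* `[K_v : ℚ_p] = 1`: the strip part is `{1}` (gen 8 `ind1StripOf_analyticLogv_eq_singleton_of_localDeg_eq_one`, UNCONDITIONAL) — nothing moves;
* `[K_v : ℚ_p]` EVEN: modulo `JannsenWingbergTwistsFirst`, some strip automorphism does NOT map `ℚ_p·1` into itself (gen 12, Kondo Lemma 2.5 (1) /
  Hoshi–Nishio Lemma 2.4);
* `[K_v : ℚ_p] ≥ 3` ODD: modulo `JannsenWingbergTwists`, the dichotomy of §2 (open in print which branch).
[claim: Mochizuki2012, status: disputed] [cite: Kondo2025OuterAutMLF, §1 p.5, §2 Lemma 2.5 (1), Remark p.12]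
[cite: HoshiNishio2022OuterAutMLF, Lemma 2.4, Rmk 2.5 p.8] [cite: DupuyHilado2025, §4.7] -/
theorem baseLine_census_of_jannsenWingberg (hJW : JannsenWingbergTwists) (hJW₁ : JannsenWingbergTwistsFirst)
    (p : ℕ) [Fact p.Prime] (hv : ((p : ℕ) : 𝓞 F) ∈ v.asIdeal) (hp2 : p ≠ 2) :
    (localDeg F v = 1 → ind1StripOf v (galoisLog v) = {AddEquiv.refl (v.adicCompletion F)}) ∧
    (Even (localDeg F v) →
      ∃ ψ : v.adicCompletion F ≃+ v.adicCompletion F, ψ ∈ ind1StripOf v (galoisLog v) ∧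
        ¬ Set.MapsTo (fun x => RescaledCompletion.of F p v hv (ψ ((RescaledCompletion.of F p v hv).symm x)))
            (Set.range (algebraMap ℚ_[p] (RescaledCompletion F p v hv)))
            (Set.range (algebraMap ℚ_[p] (RescaledCompletion F p v hv)))) ∧
    (Odd (localDeg F v) → 3 ≤ localDeg F v →
      (∃ ψ : v.adicCompletion F ≃+ v.adicCompletion F, ψ ∈ ind1StripOf v (galoisLog v) ∧
        ¬ Set.MapsTo (fun x => RescaledCompletion.of F p v hv (ψ ((RescaledCompletion.of F p v hv).symm x)))
            (Set.range (algebraMap ℚ_[p] (RescaledCompletion F p v hv)))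
            (Set.range (algebraMap ℚ_[p] (RescaledCompletion F p v hv)))) ∨
      (∃ (g : ℕ) (_ : localDeg F v = 1 + 2 * g) (y : Module.Basis (Fin 1 ⊕ Fin g × Fin 2) ℚ_[p] (RescaledCompletion F p v hv))
        (ψ ψ' : Fin g → (v.adicCompletion F ≃+ v.adicCompletion F)),
        (∀ i, ψ i ∈ ind1StripOf v (galoisLog v)) ∧ (∀ i, ψ' i ∈ ind1StripOf v (galoisLog v)) ∧
        (∀ i (x : RescaledCompletion F p v hv),
          RescaledCompletion.of F p v hv (ψ i ((RescaledCompletion.of F p v hv).symm x)) =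
            x + y.coord (Sum.inr (i, 1)) x • y (Sum.inr (i, 0))) ∧
        (∀ i (x : RescaledCompletion F p v hv),
          RescaledCompletion.of F p v hv (ψ' i ((RescaledCompletion.of F p v hv).symm x)) =
            x - y.coord (Sum.inr (i, 0)) x • y (Sum.inr (i, 1))) ∧
        Submodule.span ℚ_[p] (Set.range fun iε : Fin g × Fin 2 => y (Sum.inr iε)) =
          LinearMap.ker (Algebra.trace ℚ_[p] (RescaledCompletion F p v hv)) ∧
        (1 : RescaledCompletion F p v hv) ∈ ℚ_[p] ∙ y (Sum.inl 0))) := by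
  refine ⟨fun h1 => ?_, fun hev => ?_, fun hodd h3 => ?_⟩
  · rw [galoisLog_eq_analyticLogv]
    exact ind1StripOf_analyticLogv_eq_singleton_of_localDeg_eq_one v h1
  · have h2 : 2 ≤ localDeg F v := by
      obtain ⟨m, hm⟩ := hev
      have := localDeg_pos F v
      omega
    exact exists_mem_ind1StripOf_not_baseLinePreserving_of_jannsenWingbergFirst v hJW₁ p hv hp2 h2 hev
  · exact exists_mem_ind1StripOf_not_baseLinePreserving_or_residual_of_jannsenWingberg_odd v hJW p hv hp2 h3 hodd

/-- **Analytic-log twin of the census' odd-degree clause** (abc-iut-c312-5's canonical binder `Real.analyticLogv F v` = the Galois logarithm,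
w5-d216). [claim: Mochizuki2012, status: disputed] [cite: Kondo2025OuterAutMLF, §1 p.5, Remark p.12] -/
theorem exists_mem_ind1StripOf_analyticLogv_not_baseLinePreserving_or_residual_of_jannsenWingberg_odd (hJW : JannsenWingbergTwists)
    (p : ℕ) [Fact p.Prime] (hv : ((p : ℕ) : 𝓞 F) ∈ v.asIdeal) (hp2 : p ≠ 2) (h3 : 3 ≤ localDeg F v) (hodd : Odd (localDeg F v)) :
    (∃ ψ : v.adicCompletion F ≃+ v.adicCompletion F, ψ ∈ ind1StripOf v (analyticLogv F v) ∧
      ¬ Set.MapsTo (fun x => RescaledCompletion.of F p v hv (ψ ((RescaledCompletion.of F p v hv).symm x)))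
          (Set.range (algebraMap ℚ_[p] (RescaledCompletion F p v hv)))
          (Set.range (algebraMap ℚ_[p] (RescaledCompletion F p v hv)))) ∨
    (∃ (g : ℕ) (_ : localDeg F v = 1 + 2 * g) (y : Module.Basis (Fin 1 ⊕ Fin g × Fin 2) ℚ_[p] (RescaledCompletion F p v hv))
      (ψ ψ' : Fin g → (v.adicCompletion F ≃+ v.adicCompletion F)),
      (∀ i, ψ i ∈ ind1StripOf v (analyticLogv F v)) ∧ (∀ i, ψ' i ∈ ind1StripOf v (analyticLogv F v)) ∧
      (∀ i (x : RescaledCompletion F p v hv),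
        RescaledCompletion.of F p v hv (ψ i ((RescaledCompletion.of F p v hv).symm x)) =
          x + y.coord (Sum.inr (i, 1)) x • y (Sum.inr (i, 0))) ∧
      (∀ i (x : RescaledCompletion F p v hv),
        RescaledCompletion.of F p v hv (ψ' i ((RescaledCompletion.of F p v hv).symm x)) =
          x - y.coord (Sum.inr (i, 0)) x • y (Sum.inr (i, 1))) ∧
      Submodule.span ℚ_[p] (Set.range fun iε : Fin g × Fin 2 => y (Sum.inr iε)) =
        LinearMap.ker (Algebra.trace ℚ_[p] (RescaledCompletion F p v hv)) ∧
      (1 : RescaledCompletion F p v hv) ∈ ℚ_[p] ∙ y (Sum.inl 0)) := by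
  rw [← galoisLog_eq_analyticLogv]
  exact exists_mem_ind1StripOf_not_baseLinePreserving_or_residual_of_jannsenWingberg_odd v hJW p hv hp2 h3 hodd

end Summit.ABC.IUTFork.Thm311.Real

end
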